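import Summits.ValiantsHypothesis.ValiantsHypothesis.Theorems.PolyaContinuedSignedCoverLittleReduction
import Literature.Combinatorics.SimpleGraph.MatchingMinorProjection
import HarnessLib

/-!
# Route PolyaContinued — support item `SignedCoverLittle` (stmt-ValiantsHypothesis-7426):
# the label identity as a bijection of perfect matchings, and its restriction to subgraphs

Sequel to `PolyaContinuedSignedCoverLittleReduction.lean`, which reduced the item to the label-transfer
principle: for `H, E ⊆ Fin n × Fin n` and a relabelling `φ` of the cells, the LABEL IDENTITY
`Σ_{σ ∈ PM(H)} Π_i X (φ (i, σ i)) = PM_E` together with Pfaffian-ness of `H` should force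
Pfaffian-ness of `E`. This file turns the label identity into combinatorics (first steps of the proof
recorded in the item's evidence `proof-LabelTransfer.md`):

* `prod_X_label_eq_monomial`, `coeff_labelPoly` — the label polynomial is `Σ_{σ ⊆ H} x^{e_φ(σ)}` with
  the label exponent `e_φ(σ) = Σ_i δ_{φ(i, σ i)}`; its `d`-th coefficient counts the perfect matchings
  of `H` with label exponent `d`;
* `labelExponent_eq_matchingExponent_iff` — `e_φ(σ) = m_π` (the matching exponent of
  `PerfectMatchingPoly.lean`) iff every cell `(a, b)` is the label of exactly `[π a = b]` cells of `σ`,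
  i.e. `φ` maps the cells of `σ` bijectively onto the cells of `π` (`label_mem_of_eq`,
  `exists_label_eq_of_eq`, `label_injective_of_eq`);
* **the bijection** (`exists_perm_of_labelIdentity`, `labelExponent_injective_of_labelIdentity`,
  `exists_preimage_of_labelIdentity`): under the label identity every perfect matching `σ` of `H` has
  a unique perfect matching `π` of `E` with `e_φ(σ) = m_π`, distinct `σ` have distinct label exponents,
  and every perfect matching of `E` arises — `σ ↦ π` is a bijection `PM(H) → PM(E)` ("label-bijection");
* **restriction** (`labelIdentity_restrict`): for `E₁ ⊆ E` the label identity restricts to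
  `H₁ := {c ∈ H | φ c ∈ E₁}` and `E₁` (substitute `0` for the variables outside `E₁` on both sides;
  `aeval_deleteSubst_perfectMatchingPoly`). With `IsPfaffianBipartite.anti` this is the step
  "pass to the sub-configuration `E₁ = S ∪ μ`" of the proof.

All statements are over `ℂ` and `Fin n`, matching the route.
-/

noncomputable section

namespace Summit.ValiantsHypothesis.PolyaContinued

open MvPolynomial Finset Literature.Combinatorics.SimpleGraph

variable {n : ℕ}

/-! ### The label polynomial in exponent form -/

/-- The monomial of a relabelled perfect matching: `Π_i X (φ (i, σ i)) = x^{e_φ(σ)}` with the label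
exponent `e_φ(σ) = Σ_i δ_{φ (i, σ i)}`. [folklore] -/
theorem prod_X_label_eq_monomial (φ : Fin n × Fin n → Fin n × Fin n) (σ : Equiv.Perm (Fin n)) :
    ∏ i, (X (φ (i, σ i)) : MvPolynomial (Fin n × Fin n) ℂ) =
      monomial (∑ i, Finsupp.single (φ (i, σ i)) 1) 1 := by
  rw [monomial_sum_one]
  rfl

/-- Coefficients of the label polynomial: the coefficient of `x^d` in
`Σ_{σ ⊆ H} Π_i X (φ (i, σ i))` is the number of perfect matchings `σ` of `H` with label exponent
`e_φ(σ) = d`. [folklore] -/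
theorem coeff_labelPoly (H : Finset (Fin n × Fin n)) (φ : Fin n × Fin n → Fin n × Fin n)
    (d : (Fin n × Fin n) →₀ ℕ)
    [DecidablePred fun σ : Equiv.Perm (Fin n) =>
      (∀ i, (i, σ i) ∈ H) ∧ ∑ i, Finsupp.single (φ (i, σ i)) 1 = d] :
    coeff d (∑ σ : Equiv.Perm (Fin n), if (∀ i, (i, σ i) ∈ H) then
        ∏ i, (X (φ (i, σ i)) : MvPolynomial (Fin n × Fin n) ℂ) else 0) =
      ((Finset.univ.filter fun σ : Equiv.Perm (Fin n) =>
        (∀ i, (i, σ i) ∈ H) ∧ ∑ i, Finsupp.single (φ (i, σ i)) 1 = d).card : ℂ) := by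
  classical
  rw [coeff_sum]
  have : ∀ σ : Equiv.Perm (Fin n),
      coeff d (if (∀ i, (i, σ i) ∈ H) then
        ∏ i, (X (φ (i, σ i)) : MvPolynomial (Fin n × Fin n) ℂ) else 0) =
      if (∀ i, (i, σ i) ∈ H) ∧ ∑ i, Finsupp.single (φ (i, σ i)) 1 = d then 1 else 0 := by
    intro σ
    by_cases hσ : ∀ i, (i, σ i) ∈ H
    · rw [if_pos hσ, prod_X_label_eq_monomial, coeff_monomial]
      by_cases hd : ∑ i, Finsupp.single (φ (i, σ i)) 1 = d
      · rw [if_pos hd, if_pos ⟨hσ, hd⟩]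
      · rw [if_neg hd, if_neg fun h => hd h.2]
    · rw [if_neg hσ, coeff_zero, if_neg fun h => hσ h.1]
  simp_rw [this]
  rw [Finset.sum_boole]

/-- Under the label identity, the number of perfect matchings of `H` with label exponent `d` is `1`
if `d` is the matching exponent of a perfect matching of `E`, and `0` otherwise. [folklore] -/
theorem card_filter_labelExponent_eq (H E : Finset (Fin n × Fin n))
    (φ : Fin n × Fin n → Fin n × Fin n)
    (hid : (∑ σ : Equiv.Perm (Fin n), if (∀ i, (i, σ i) ∈ H) then
        ∏ i, (X (φ (i, σ i)) : MvPolynomial (Fin n × Fin n) ℂ) else 0) =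
      perfectMatchingPoly E ℂ)
    (d : (Fin n × Fin n) →₀ ℕ)
    [DecidablePred fun σ : Equiv.Perm (Fin n) =>
      (∀ i, (i, σ i) ∈ H) ∧ ∑ i, Finsupp.single (φ (i, σ i)) 1 = d]
    [Decidable (∃ π : Equiv.Perm (Fin n), (∀ i, (i, π i) ∈ E) ∧ matchingExponent π = d)] :
    (Finset.univ.filter fun σ : Equiv.Perm (Fin n) =>
        (∀ i, (i, σ i) ∈ H) ∧ ∑ i, Finsupp.single (φ (i, σ i)) 1 = d).card =
      if ∃ π : Equiv.Perm (Fin n), (∀ i, (i, π i) ∈ E) ∧ matchingExponent π = d then 1 else 0 := by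
  have h := congrArg (coeff d) hid
  rw [coeff_labelPoly, coeff_perfectMatchingPoly] at h
  split_ifs at h with hex
  · rw [if_pos hex]; exact_mod_cast h
  · rw [if_neg hex]; exact_mod_cast h

/-! ### Label exponent = matching exponent: `φ` maps the cells of `σ` onto those of `π` -/

/-- Values of the label exponent: `e_φ(σ) (c)` is the number of cells of `σ` labelled `c`. [folklore] -/
theorem labelExponent_apply (φ : Fin n × Fin n → Fin n × Fin n) (σ : Equiv.Perm (Fin n))
    (c : Fin n × Fin n) [DecidablePred fun i : Fin n => φ (i, σ i) = c] :
    (∑ i, Finsupp.single (φ (i, σ i)) 1 : (Fin n × Fin n) →₀ ℕ) c =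
      (Finset.univ.filter fun i : Fin n => φ (i, σ i) = c).card := by
  classical
  rw [Finsupp.finsetSum_apply]
  simp only [Finsupp.single_apply]
  rw [Finset.sum_boole, Nat.cast_id]

/-- `e_φ(σ) = m_π` iff, for every cell `(a, b)`, the number of cells of `σ` labelled `(a, b)` is `1`
if `π a = b` and `0` otherwise. [folklore] -/
theorem labelExponent_eq_matchingExponent_iff (φ : Fin n × Fin n → Fin n × Fin n)
    (σ π : Equiv.Perm (Fin n)) [∀ c : Fin n × Fin n, DecidablePred fun i : Fin n => φ (i, σ i) = c] :
    (∑ i, Finsupp.single (φ (i, σ i)) 1 : (Fin n × Fin n) →₀ ℕ) = matchingExponent π ↔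
      ∀ a b : Fin n, (Finset.univ.filter fun i : Fin n => φ (i, σ i) = (a, b)).card =
        if π a = b then 1 else 0 := by
  constructor
  · intro h a b
    have key : (∑ i, Finsupp.single (φ (i, σ i)) 1 : (Fin n × Fin n) →₀ ℕ) (a, b) =
        matchingExponent π (a, b) := by rw [h]
    rw [labelExponent_apply, matchingExponent_apply] at key
    exact key
  · intro h
    ext ⟨a, b⟩
    rw [labelExponent_apply, matchingExponent_apply]
    exact h a b

/-- If `e_φ(σ) = m_π` then every label of a cell of `σ` is a cell of `π`. [folklore] -/
theorem label_mem_of_eq {φ : Fin n × Fin n → Fin n × Fin n} {σ π : Equiv.Perm (Fin n)}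
    (h : (∑ i, Finsupp.single (φ (i, σ i)) 1 : (Fin n × Fin n) →₀ ℕ) = matchingExponent π)
    (i : Fin n) : π (φ (i, σ i)).1 = (φ (i, σ i)).2 := by
  classical
  have hc := (labelExponent_eq_matchingExponent_iff φ σ π).1 h (φ (i, σ i)).1 (φ (i, σ i)).2
  by_contra hne
  rw [if_neg hne, Finset.card_eq_zero, Finset.filter_eq_empty_iff] at hc
  exact hc (Finset.mem_univ i) rfl

/-- If `e_φ(σ) = m_π` then every cell `(a, π a)` of `π` is the label of some cell of `σ`. [folklore] -/
theorem exists_label_eq_of_eq {φ : Fin n × Fin n → Fin n × Fin n} {σ π : Equiv.Perm (Fin n)}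
    (h : (∑ i, Finsupp.single (φ (i, σ i)) 1 : (Fin n × Fin n) →₀ ℕ) = matchingExponent π)
    (a : Fin n) : ∃ i, φ (i, σ i) = (a, π a) := by
  classical
  have hc := (labelExponent_eq_matchingExponent_iff φ σ π).1 h a (π a)
  rw [if_pos rfl] at hc
  obtain ⟨i, hi⟩ := Finset.card_pos.1 (by omega : 0 < (Finset.univ.filter
    fun i : Fin n => φ (i, σ i) = (a, π a)).card)
  exact ⟨i, (Finset.mem_filter.1 hi).2⟩

/-- If `e_φ(σ) = m_π` then `φ` is injective on the cells of `σ`. [folklore] -/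
theorem label_injective_of_eq {φ : Fin n × Fin n → Fin n × Fin n} {σ π : Equiv.Perm (Fin n)}
    (h : (∑ i, Finsupp.single (φ (i, σ i)) 1 : (Fin n × Fin n) →₀ ℕ) = matchingExponent π) :
    Function.Injective fun i : Fin n => φ (i, σ i) := by
  classical
  intro i j hij
  have hc := (labelExponent_eq_matchingExponent_iff φ σ π).1 h (φ (i, σ i)).1 (φ (i, σ i)).2
  have hle : (Finset.univ.filter fun k : Fin n => φ (k, σ k) = ((φ (i, σ i)).1, (φ (i, σ i)).2)).card
      ≤ 1 := by
    rw [hc]; split_ifs <;> omega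
  rw [Finset.card_le_one] at hle
  refine hle i ?_ j ?_
  · exact Finset.mem_filter.2 ⟨Finset.mem_univ _, rfl⟩
  · exact Finset.mem_filter.2 ⟨Finset.mem_univ _, by simp only [Prod.mk.eta]; exact hij.symm⟩

/-! ### The label-bijection -/

/-- **Existence.** Under the label identity every perfect matching `σ` of `H` is labelled by a perfect
matching of `E`: some `π ⊆ E` has `e_φ(σ) = m_π` (unique, by `matchingExponent_injective`).
[folklore] -/
theorem exists_perm_of_labelIdentity {H E : Finset (Fin n × Fin n)}
    {φ : Fin n × Fin n → Fin n × Fin n}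
    (hid : (∑ σ : Equiv.Perm (Fin n), if (∀ i, (i, σ i) ∈ H) then
        ∏ i, (X (φ (i, σ i)) : MvPolynomial (Fin n × Fin n) ℂ) else 0) =
      perfectMatchingPoly E ℂ)
    {σ : Equiv.Perm (Fin n)} (hσ : ∀ i, (i, σ i) ∈ H) :
    ∃ π : Equiv.Perm (Fin n), (∀ i, (i, π i) ∈ E) ∧
      (∑ i, Finsupp.single (φ (i, σ i)) 1 : (Fin n × Fin n) →₀ ℕ) = matchingExponent π := by
  classical
  have hc := card_filter_labelExponent_eq H E φ hid (∑ i, Finsupp.single (φ (i, σ i)) 1)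
  split_ifs at hc with hex
  · obtain ⟨π, hπ, hd⟩ := hex
    exact ⟨π, hπ, hd.symm⟩
  · rw [Finset.card_eq_zero, Finset.filter_eq_empty_iff] at hc
    exact absurd ⟨hσ, rfl⟩ (hc (Finset.mem_univ σ))

/-- **Injectivity.** Under the label identity distinct perfect matchings of `H` have distinct label
exponents (hence distinct image matchings). [folklore] -/
theorem labelExponent_injective_of_labelIdentity {H E : Finset (Fin n × Fin n)}
    {φ : Fin n × Fin n → Fin n × Fin n}
    (hid : (∑ σ : Equiv.Perm (Fin n), if (∀ i, (i, σ i) ∈ H) then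
        ∏ i, (X (φ (i, σ i)) : MvPolynomial (Fin n × Fin n) ℂ) else 0) =
      perfectMatchingPoly E ℂ)
    {σ σ' : Equiv.Perm (Fin n)} (hσ : ∀ i, (i, σ i) ∈ H) (hσ' : ∀ i, (i, σ' i) ∈ H)
    (h : (∑ i, Finsupp.single (φ (i, σ i)) 1 : (Fin n × Fin n) →₀ ℕ) =
      ∑ i, Finsupp.single (φ (i, σ' i)) 1) : σ = σ' := by
  classical
  have hc := card_filter_labelExponent_eq H E φ hid (∑ i, Finsupp.single (φ (i, σ i)) 1)
  have hle : (Finset.univ.filter fun τ : Equiv.Perm (Fin n) => (∀ i, (i, τ i) ∈ H) ∧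
      ∑ i, Finsupp.single (φ (i, τ i)) 1 = ∑ i, Finsupp.single (φ (i, σ i)) 1).card ≤ 1 := by
    rw [hc]; split_ifs <;> omega
  rw [Finset.card_le_one] at hle
  exact hle σ (Finset.mem_filter.2 ⟨Finset.mem_univ _, hσ, rfl⟩) σ'
    (Finset.mem_filter.2 ⟨Finset.mem_univ _, hσ', h.symm⟩)

/-- **Surjectivity.** Under the label identity every perfect matching `π` of `E` is the image of some
perfect matching `σ` of `H`: `e_φ(σ) = m_π`. [folklore] -/
theorem exists_preimage_of_labelIdentity {H E : Finset (Fin n × Fin n)}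
    {φ : Fin n × Fin n → Fin n × Fin n}
    (hid : (∑ σ : Equiv.Perm (Fin n), if (∀ i, (i, σ i) ∈ H) then
        ∏ i, (X (φ (i, σ i)) : MvPolynomial (Fin n × Fin n) ℂ) else 0) =
      perfectMatchingPoly E ℂ)
    {π : Equiv.Perm (Fin n)} (hπ : ∀ i, (i, π i) ∈ E) :
    ∃ σ : Equiv.Perm (Fin n), (∀ i, (i, σ i) ∈ H) ∧
      (∑ i, Finsupp.single (φ (i, σ i)) 1 : (Fin n × Fin n) →₀ ℕ) = matchingExponent π := by
  classical
  have hc := card_filter_labelExponent_eq H E φ hid (matchingExponent π)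
  rw [if_pos ⟨π, hπ, rfl⟩] at hc
  obtain ⟨σ, hσ⟩ := Finset.card_pos.1 (by omega : 0 < (Finset.univ.filter
    fun σ : Equiv.Perm (Fin n) => (∀ i, (i, σ i) ∈ H) ∧
      ∑ i, Finsupp.single (φ (i, σ i)) 1 = matchingExponent π).card)
  exact ⟨σ, (Finset.mem_filter.1 hσ).2⟩

/-! ### Restriction to a subgraph of `E` -/

/-- **Restriction of the label identity.** If `Σ_{σ ⊆ H} Π_i X (φ (i, σ i)) = PM_E` and `E₁ ⊆ E`,
then the same identity holds for `H₁ = {c ∈ H | φ c ∈ E₁}` and `E₁`: substitute `0` for the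
variables outside `E₁` on both sides. (The perfect matchings of `H₁` are exactly those of `H` whose
labels lie in `E₁`.) [folklore] -/
theorem labelIdentity_restrict {H E E₁ : Finset (Fin n × Fin n)}
    {φ : Fin n × Fin n → Fin n × Fin n} (hE : E₁ ⊆ E)
    (hid : (∑ σ : Equiv.Perm (Fin n), if (∀ i, (i, σ i) ∈ H) then
        ∏ i, (X (φ (i, σ i)) : MvPolynomial (Fin n × Fin n) ℂ) else 0) =
      perfectMatchingPoly E ℂ) :
    (∑ σ : Equiv.Perm (Fin n), if (∀ i, (i, σ i) ∈ H.filter fun c => φ c ∈ E₁) then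
        ∏ i, (X (φ (i, σ i)) : MvPolynomial (Fin n × Fin n) ℂ) else 0) =
      perfectMatchingPoly E₁ ℂ := by
  classical
  have h := congrArg (aeval (deleteSubst (k := ℂ) E₁)) hid
  rw [aeval_deleteSubst_perfectMatchingPoly hE, map_sum] at h
  rw [← h]
  refine Finset.sum_congr rfl fun σ _ => ?_
  by_cases hσ : ∀ i, (i, σ i) ∈ H
  · rw [if_pos hσ, map_prod]
    simp only [aeval_X, deleteSubst]
    rw [Fintype.prod_ite_zero]
    by_cases hE₁ : ∀ i, φ (i, σ i) ∈ E₁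
    · rw [if_pos (fun i => Finset.mem_filter.2 ⟨hσ i, hE₁ i⟩), if_pos hE₁]
    · have hnot : ¬ ∀ i, (i, σ i) ∈ H.filter fun c => φ c ∈ E₁ := by
        intro hall
        refine hE₁ fun i => ?_
        have hi : (i, σ i) ∈ H.filter fun c => φ c ∈ E₁ := hall i
        rw [Finset.mem_filter] at hi
        exact hi.2
      rw [if_neg hnot, if_neg hE₁]
  · have hnot : ¬ ∀ i, (i, σ i) ∈ H.filter fun c => φ c ∈ E₁ := by
      intro hall
      refine hσ fun i => ?_
      have hi : (i, σ i) ∈ H.filter fun c => φ c ∈ E₁ := hall i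
      rw [Finset.mem_filter] at hi
      exact hi.1
    rw [if_neg hnot, if_neg hσ, map_zero]

end Summit.ValiantsHypothesis.PolyaContinued
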